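import Summits.CriticalPhenomena.PercolationContinuityZ3.Theses.PercAxialLogConvexity
import Summits.CriticalPhenomena.PercolationContinuityZ3.Theorems.PercAxialLogConvexityBlockCrossoverStubAxialMass
import Summits.CriticalPhenomena.PercolationContinuityZ3.Theorems.PercAxialLogConvexityBlockCrossoverStubMassVanishes

/-!
# Delimiters for the crux `BlockCrossover` (stmt-CriticalPhenomena-11550, line `registered`)

Write `a_p(n) = τ_p(0, n e₁) = tau 3 p 0 (Pi.single 0 n)`, `f_p = log a_p`, and
`D_p(n) = f_{p_c}(n) - f_p(n) ≥ 0` for the *crossover deficit* of `p ≤ p_c(ℤ³)`. The block clause of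
`BlockCrossover` at scale `N` reads, after taking logarithms,
`D_p(n+1) - D_p(n) ≤ c'/N` for `N/2 ≤ n ≤ N` (increments of the deficit on the top dyadic block are
at most `c'/N`), while clause (a) (`a_p(n) ≤ C e^{-(c/N) n}`) together with `φ(p_c) = 0` forces
`D_p(n)/n → m(p) ≥ c/N > c'/N` eventually. This file proves:

* `mass_criticalProbI_eq_zero` — **`φ(p_c) = 0` in axial form on `ℤ³`** (Grimmett 1999 Thm. (6.14),
  (6.18)): the Fekete limit `lim -log τ_{p_c}(0, n e₁)/n` is `0`, i.e.
  `HasInvCorrLength (tau 3 p_c 0) 0` (Kozma–Nachmias Lemma 3.1 + reflection doubling, as in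
  `stub_massVanishes`, evaluated AT `p_c`).
* `blockCrossover_false_of_concaveDeficits` — **the concave-deficit obstruction**: if for every
  `0 < p ≤ p_c` the deficit `n ↦ D_p(n)` is concave on `ℕ`, then `BlockCrossover` is FALSE. (A concave
  non-negative sequence has non-negative, non-increasing increments, all `≥ lim D_p(n)/n`; clause (a)
  and `φ(p_c) = 0` make that limit `≥ c/N`, contradicting the block clause `≤ c'/N < c/N`; the branch
  `c' < 0` contradicts non-negativity directly.)

The hypothesis of the obstruction is the `d = 2`-like world (`D(t) ≍ t^{1/ν}` with `1/ν < 1` is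
concave); on `ℤ³` scaling theory predicts `1/ν ≈ 1.141 > 1`, an early-CONVEX deficit, and the
obstruction does not fire — it records formally that `BlockCrossover` carries exactly this
"early convexity of the crossover deficit" content (route text: "in d = 2 the clause should FAIL").
It is a delimiter, not a step towards `¬ BlockCrossover`.
-/

noncomputable section

namespace Summit.CriticalPhenomena.PercolationContinuityZ3.Theorems.BlockCrossover

open MeasureTheory Filter Topology
open Literature.Probability.Percolation Literature.Probability.LatticeModels

namespace Delimiters

/-! ### `φ(p_c) = 0` along the axis -/

/-- **`φ(p_c) = 0` (axial form, `ℤ³`)**: the Fekete limit `m(p_c) = lim -log τ_{p_c}(0, n e₁)/n`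
vanishes (Grimmett 1999, Thm. (6.14), (6.18)). Proof: `m(p_c) ≤ -log τ_{p_c}(0, 2r e₁)/(2r)`
(`rate_le_quotient`) and `τ_{p_c}(0, 2r e₁) ≥ (1/(6(2r+1)³))²` (Kozma–Nachmias Lemma 3.1 +
reflection doubling: `exists_sphere_tau_ge`, `sq_le_tau_axis`), so `m(p_c) < ε` for every `ε > 0`
(`exists_rate_bound_lt`); and `m(p_c) ≥ 0`. -/
theorem lim_criticalProbI_eq_zero (hpc : 0 < ((criticalProbI 3 : unitInterval) : ℝ)) :
    (StubAxialMass.subadditive_neg_log_tau_axial (d := 3) (criticalProbI 3) hpc).lim = 0 := by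
  set L := (StubAxialMass.subadditive_neg_log_tau_axial (d := 3) (criticalProbI 3) hpc).lim with hL
  have hicl : HasInvCorrLength (tau 3 (criticalProbI 3) 0) L :=
    StubAxialMass.hasInvCorrLength_tau (criticalProbI 3) hpc
  have hnn : 0 ≤ L :=
    ge_of_tendsto' (StubAxialMass.tendsto_neg_log_tau_axial_div (d := 3) (criticalProbI 3)
      hpc) fun n => StubAxialMass.neg_log_tau_axial_div_nonneg _ n
  refine le_antisymm (le_of_forall_pos_lt_add fun ε hε => ?_) hnn
  rw [zero_add]
  obtain ⟨r, hr1, hrε⟩ := StubMassVanishes.exists_rate_bound_lt hε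
  obtain ⟨z, hz, hδ⟩ := StubMassVanishes.exists_sphere_tau_ge r
  set v : Site 3 := (((2 * r : ℕ) : ℤ) • Pi.single (0 : Fin 3) (1 : ℤ)) with hv
  set δ : ℝ := 1 / (6 * (2 * (r : ℝ) + 1) ^ 3) with hδdef
  have hδpos : 0 < δ := by positivity
  have hη : δ ^ 2 ≤ tau 3 (criticalProbI 3) 0 v :=
    (pow_le_pow_left₀ hδpos.le hδ 2).trans (StubMassVanishes.sq_le_tau_axis (criticalProbI 3) hz)
  have hn1 : 1 ≤ 2 * r := by omega
  have hA : L ≤ -Real.log (tau 3 (criticalProbI 3) 0 v) / ((2 * r : ℕ) : ℝ) :=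
    StubMassVanishes.rate_le_quotient hpc hicl hn1
  have hlt : δ ^ 2 / 2 < tau 3 (criticalProbI 3) 0 v := by
    have : 0 < δ ^ 2 := by positivity
    linarith
  have h72 : Real.log (72 * (2 * (r : ℝ) + 1) ^ 6) = -Real.log (δ ^ 2 / 2) := by
    rw [← Real.log_inv]
    congr 1
    rw [hδdef]
    field_simp
    ring
  have hlogle : -Real.log (tau 3 (criticalProbI 3) 0 v) < Real.log (72 * (2 * (r : ℝ) + 1) ^ 6) := by
    rw [h72, neg_lt_neg_iff]
    exact Real.log_lt_log (by positivity) hlt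
  have hnR : ((2 * r : ℕ) : ℝ) = 2 * (r : ℝ) := by push_cast; ring
  calc L ≤ -Real.log (tau 3 (criticalProbI 3) 0 v) / ((2 * r : ℕ) : ℝ) := hA
    _ < Real.log (72 * (2 * (r : ℝ) + 1) ^ 6) / (2 * r) := by
        rw [hnR]
        exact div_lt_div_of_pos_right hlogle (by positivity)
    _ < ε := hrε

/-- **`φ(p_c) = 0`**, junk-free form: `HasInvCorrLength (tau 3 p_c 0) 0`, i.e.
`-log τ_{p_c}(0, n e₁)/n → 0` (Grimmett 1999, Thm. (6.14), (6.18)). -/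
theorem mass_criticalProbI_eq_zero : HasInvCorrLength (tau 3 (criticalProbI 3) 0) 0 := by
  have hpc : 0 < ((criticalProbI 3 : unitInterval) : ℝ) := by
    rw [coe_criticalProbI]; exact_mod_cast criticalProb_zd_pos 3 (by norm_num)
  have h := StubAxialMass.hasInvCorrLength_tau (d := 3) (criticalProbI 3) hpc
  rwa [lim_criticalProbI_eq_zero hpc] at h

/-- `-log τ_{p_c}(0, n e₁)/n → 0` in the `Pi.single 0 n` spelling. -/
theorem tendsto_neg_log_tau_criticalProbI_div :
    Tendsto (fun n : ℕ => -Real.log (tau 3 (criticalProbI 3) 0 (Pi.single 0 (n : ℤ))) / (n : ℝ))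
      atTop (𝓝 0) := by
  have hpc : 0 < ((criticalProbI 3 : unitInterval) : ℝ) := by
    rw [coe_criticalProbI]; exact_mod_cast criticalProb_zd_pos 3 (by norm_num)
  have h := StubAxialMass.tendsto_neg_log_tau_axial_div (d := 3) (criticalProbI 3) hpc
  rwa [lim_criticalProbI_eq_zero hpc] at h

/-! ### Concave sequences on `ℕ` -/

/-- Increments of a concave sequence are non-increasing: `D(N+j+1) - D(N+j) ≤ D(N+1) - D(N)`. -/
theorem concave_increment_le (D : ℕ → ℝ)
    (hconc : ∀ n, D (n + 2) - D (n + 1) ≤ D (n + 1) - D n) (N : ℕ) :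
    ∀ j : ℕ, D (N + j + 1) - D (N + j) ≤ D (N + 1) - D N := by
  intro j
  induction j with
  | zero => simp
  | succ j ih =>
    have h := hconc (N + j)
    have e1 : N + (j + 1) + 1 = N + j + 2 := by omega
    have e2 : N + (j + 1) = N + j + 1 := by omega
    rw [e1, e2]
    linarith

/-- A concave sequence lies below its tangent line: `D(N+j) ≤ D(N) + j (D(N+1) - D(N))`. -/
theorem concave_le_linear (D : ℕ → ℝ)
    (hconc : ∀ n, D (n + 2) - D (n + 1) ≤ D (n + 1) - D n) (N : ℕ) :
    ∀ j : ℕ, D (N + j) ≤ D N + j * (D (N + 1) - D N) := by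
  intro j
  induction j with
  | zero => simp
  | succ j ih =>
    have h := concave_increment_le D hconc N j
    have e : N + (j + 1) = N + j + 1 := by omega
    rw [e]
    push_cast
    linarith

/-- A concave sequence bounded below has non-negative increments. -/
theorem concave_increment_nonneg (D : ℕ → ℝ)
    (hconc : ∀ n, D (n + 2) - D (n + 1) ≤ D (n + 1) - D n) (hbdd : ∀ n, 0 ≤ D n) (N : ℕ) :
    0 ≤ D (N + 1) - D N := by
  by_contra hneg
  push Not at hneg
  set η := -(D (N + 1) - D N) with hη
  have hηpos : 0 < η := by rw [hη]; linarith
  obtain ⟨j, hj⟩ := exists_nat_gt (D N / η)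
  have hlin := concave_le_linear D hconc N j
  have hDN : 0 ≤ D N := hbdd N
  have h1 : D N < j * η := by rwa [div_lt_iff₀ hηpos] at hj
  have h2 : D (N + j) ≤ D N - j * η := by rw [hη]; linarith
  have h3 := hbdd (N + j)
  linarith

/-! ### The obstruction -/

/-- **Concave-deficit obstruction.** If for every `0 < p ≤ p_c(ℤ³)` the crossover deficit
`n ↦ log τ_{p_c}(0, n e₁) - log τ_p(0, n e₁)` is concave on `ℕ`, then the crux `BlockCrossover`
of route `PercAxialLogConvexity` is false. (Delimiter: the hypothesis describes a `1/ν < 1` world;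
on `ℤ³`, `1/ν ≈ 1.141` and the near-critical deficit is predicted to be convex at small `n/ξ`.) -/
theorem blockCrossover_false_of_concaveDeficits
    (hconc : ∀ p : unitInterval, 0 < (p : ℝ) → p ≤ criticalProbI 3 → ∀ n : ℕ,
      (Real.log (tau 3 (criticalProbI 3) 0 (Pi.single 0 ((n + 2 : ℕ) : ℤ))) -
          Real.log (tau 3 p 0 (Pi.single 0 ((n + 2 : ℕ) : ℤ)))) -
        (Real.log (tau 3 (criticalProbI 3) 0 (Pi.single 0 ((n + 1 : ℕ) : ℤ))) -
          Real.log (tau 3 p 0 (Pi.single 0 ((n + 1 : ℕ) : ℤ)))) ≤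
      (Real.log (tau 3 (criticalProbI 3) 0 (Pi.single 0 ((n + 1 : ℕ) : ℤ))) -
          Real.log (tau 3 p 0 (Pi.single 0 ((n + 1 : ℕ) : ℤ)))) -
        (Real.log (tau 3 (criticalProbI 3) 0 (Pi.single 0 (n : ℤ))) -
          Real.log (tau 3 p 0 (Pi.single 0 (n : ℤ))))) :
    ¬ Summit.CriticalPhenomena.PercolationContinuityZ3.Theses.PercAxialLogConvexity.BlockCrossover := by
  rintro ⟨c, c', hcc, p, N, C, hp, hN, ha, hb⟩
  obtain ⟨k, hk⟩ := hN 1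
  -- the deficit of `p k`
  set q : unitInterval := p k with hq
  have hq0 : 0 < (q : ℝ) := (hp k).1
  have hqc : q ≤ criticalProbI 3 := (hp k).2
  set a : ℕ → ℝ := fun n => tau 3 q 0 (Pi.single 0 (n : ℤ)) with ha_def
  set b : ℕ → ℝ := fun n => tau 3 (criticalProbI 3) 0 (Pi.single 0 (n : ℤ)) with hb_def
  have hapos : ∀ n, 0 < a n := fun n => StubAxialMass.tau_axial_pos (d := 3) q hq0 n
  have hpc : 0 < ((criticalProbI 3 : unitInterval) : ℝ) := by
    rw [coe_criticalProbI]; exact_mod_cast criticalProb_zd_pos 3 (by norm_num)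
  have hbpos : ∀ n, 0 < b n := fun n =>
    StubAxialMass.tau_axial_pos (d := 3) (criticalProbI 3) hpc n
  have hab : ∀ n, a n ≤ b n := fun n =>
    DCT16.real_mono_of_isUpperSet (zdGraph 3) (isUpperSet_openConn _ _)
      (measurableSet_openConn_holds _ _) hqc
  set D : ℕ → ℝ := fun n => Real.log (b n) - Real.log (a n) with hD
  have hDconc : ∀ n, D (n + 2) - D (n + 1) ≤ D (n + 1) - D n := fun n => hconc q hq0 hqc n
  have hDnn : ∀ n, 0 ≤ D n := fun n => by
    have := Real.log_le_log (hapos n) (hab n)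
    simp only [hD]; linarith
  have hinc := concave_increment_nonneg D hDconc hDnn
  -- the block clause at `n = N k`, in logarithms: `D (N k + 1) - D (N k) ≤ c' / N k`
  set M : ℕ := N k with hM
  have hMpos : (0 : ℝ) < M := by exact_mod_cast (show 0 < M by omega)
  have hbM := hb k M (by rw [← hM]; linarith) le_rfl
  have hinc_le : D (M + 1) - D M ≤ c' / M := by
    have hlhs : 0 < Real.exp (-(c' / (N k : ℝ))) * (a M * b (M + 1)) :=
      mul_pos (Real.exp_pos _) (mul_pos (hapos M) (hbpos (M + 1)))
    have hlog := Real.log_le_log hlhs hbM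
    rw [Real.log_mul (Real.exp_pos _).ne' (mul_pos (hapos M) (hbpos (M + 1))).ne', Real.log_exp,
      Real.log_mul (hapos M).ne' (hbpos (M + 1)).ne',
      Real.log_mul (hapos (M + 1)).ne' (hbpos M).ne'] at hlog
    simp only [hD]
    linarith
  by_cases hc' : c' < 0
  · -- `c' < 0`: the increment would be negative
    have : c' / (M : ℝ) < 0 := div_neg_of_neg_of_pos hc' hMpos
    linarith [hinc M]
  · -- `0 ≤ c' < c`: clause (a) + concavity force exponential decay of `τ_{p_c}` along the axis
    push Not at hc'
    have hc : 0 < c := lt_of_le_of_lt hc' hcc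
    -- `C k ≥ 1 > 0` from `n = 0`
    have hC : 1 ≤ C k := by
      have h0 := ha k 0
      simp only [Nat.cast_zero, mul_zero, Real.exp_zero, mul_one] at h0
      have h1 : tau 3 (p k) 0 (Pi.single (0 : Fin 3) (0 : ℤ)) = 1 := by
        rw [Pi.single_zero]; exact tau_self _ _
      linarith
    have hCpos : 0 < C k := by linarith
    -- `log a n ≤ log C - (c/M) n`
    have hloga : ∀ n : ℕ, Real.log (a n) ≤ Real.log (C k) - c / M * n := by
      intro n
      have h1 := ha k n
      have h2 := Real.log_le_log (hapos n) h1
      rw [Real.log_mul hCpos.ne' (Real.exp_pos _).ne', Real.log_exp] at h2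
      simp only [← hM] at h2
      linarith
    -- `log b (M + j) ≤ K - j (c - c')/M` with `K = D M + log C - c`
    have hlogb : ∀ j : ℕ, Real.log (b (M + j)) ≤
        (D M + Real.log (C k) - c) - j * ((c - c') / M) := by
      intro j
      have h1 := concave_le_linear D hDconc M j
      have h2 := hloga (M + j)
      have h3 : (j : ℝ) * (D (M + 1) - D M) ≤ j * (c' / M) :=
        mul_le_mul_of_nonneg_left hinc_le (Nat.cast_nonneg j)
      have hDMj : D (M + j) = Real.log (b (M + j)) - Real.log (a (M + j)) := rfl
      have hMne : (M : ℝ) ≠ 0 := hMpos.ne'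
      have e1 : c / M * ((M + j : ℕ) : ℝ) = c + j * (c / M) := by
        push_cast
        field_simp
      rw [e1] at h2
      have e2 : (j : ℝ) * ((c - c') / M) = j * (c / M) - j * (c' / M) := by ring
      rw [e2]
      linarith
    -- hence `-log b n / n ≥ (c - c')/(2M)` for all large `n`, contradicting `φ(p_c) = 0`
    have hrate : 0 < (c - c') / M := div_pos (by linarith) hMpos
    have hev : ∀ᶠ n : ℕ in atTop, (c - c') / (2 * M) ≤ -Real.log (b n) / n := by
      set K : ℝ := D M + Real.log (C k) - c with hK
      -- choose `j₀` with `j₀ (c - c')/M ≥ 2 (|K| + M (c - c')/M)`-type slack; simplest: all `n ≥ n₀`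
      obtain ⟨j₀, hj₀⟩ := exists_nat_gt ((2 * |K| + (c - c')) / ((c - c') / M))
      refine eventually_atTop.2 ⟨M + j₀ + 1, fun n hn => ?_⟩
      obtain ⟨j, rfl⟩ : ∃ j, n = M + j := ⟨n - M, by omega⟩
      have hj : (j₀ : ℝ) ≤ j := by exact_mod_cast (show j₀ ≤ j by omega)
      have hnpos : (0 : ℝ) < ((M + j : ℕ) : ℝ) := by positivity
      rw [le_div_iff₀ hnpos]
      have h1 := hlogb j
      have hj₀' : 2 * |K| + (c - c') < j₀ * ((c - c') / M) := by
        rwa [div_lt_iff₀ hrate] at hj₀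
      have hjj : (j₀ : ℝ) * ((c - c') / M) ≤ j * ((c - c') / M) :=
        mul_le_mul_of_nonneg_right hj hrate.le
      have hKabs : K ≤ |K| := le_abs_self K
      have hMj : (c - c') / (2 * M) * ((M + j : ℕ) : ℝ) = (c - c') / 2 + j * ((c - c') / M) / 2 := by
        push_cast
        field_simp
      rw [hMj]
      have habsnn : 0 ≤ |K| := abs_nonneg K
      linarith
    -- the limit is `0`
    have hlim := tendsto_neg_log_tau_criticalProbI_div
    have hle : (c - c') / (2 * M) ≤ 0 :=
      ge_of_tendsto hlim hev
    have : 0 < (c - c') / (2 * M) := div_pos (by linarith) (by positivity)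
    linarith

end Delimiters

end Summit.CriticalPhenomena.PercolationContinuityZ3.Theorems.BlockCrossover

end
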